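import Summits.ABC.ABC.Theses.DefiniteXi
import Summits.ABC.ABC.Theorems.DefiniteXiFreyModularityIsModular
import Summits.ABC.ABC.Theorems.DefiniteXiFreyModularityStubAbsIrrNegThree
import Summits.ABC.ABC.Theorems.DefiniteXiEisensteinQuarantineFreyEigenLinePrime
import Summits.ABC.ABC.Theorems.EisensteinQuarantine.Negative.EisensteinQuarantineFalseOfProthDepthFamily
import Summits.ABC.ABC.Theorems.DefiniteXiEisensteinQuarantineThreeAdicCalibration
import Summits.ABC.ABC.Theorems.XiBound.Negative.XiBoundDomainSetup
import Literature.NumberTheory.Automorphic.CDTTheorem722TwoFactsProofs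
import Literature.NumberTheory.Automorphic.CDTTheorem712TwoLiftsProofs
import Literature.NumberTheory.EllipticCurves.CuspFormLFunctionLevelConductorProofs
import Literature.NumberTheory.EllipticCurves.SerreFreyValuationProductProofs
import Literature.NumberTheory.Sieve.PrimesInAPTwoPowerModuli
import HarnessLib

/-!
# STUB-IDEAS `stub_freyModularity` (k = 1) — helper signatures, elaborated

Crux `EisensteinQuarantine` (stmt-ABC-15023), line `forced-pair-dlog`, stub
`stub_freyModularity : Summit.ABC.ABC.Theses.DefiniteXi.FreyModularity` (= item stmt-ABC-11340 verbatim).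

* P1 (tree match by name): the stub is the route item; closers by name.
* P3 (use-site scope, FAMILY 2 reshape surfaced by the match): the composition `ProthDepthFamily_of`
  consumes `FreyModularity` ONLY at the forced family `E_(−ℓ, ℓ−1)`, `ℓ` prime, `32 ∣ ℓ − 1`.
  Restricting the prime supply to `ℓ ≡ 2 (mod 3)` puts every member in CASE A (`3 ∤ ℓ(ℓ−1)`,
  R3 = `isAbsIrreducibleOverSqrt_negThree_freyCurve_of_not_three_dvd`, PROVED), where modularity is
  `CDT_theorem_7_2_1` alone (landed `isModular_freyCurve_of_CDT_theorem_7_2_1_of_not_three_dvd`), and —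
  atom-wise — Langlands–Tunnell + Wiles/Taylor–Wiles at `3` + Eichler–Shimura, with Carayol PROVED in the
  squarefree scope (`IsNewformOf.level_eq_conductorNorm_of_squarefree`).  No `3–5` switch, no lifting at `5`.
-/

set_option linter.dupNamespace false
set_option linter.unusedVariables false

noncomputable section

namespace Summit.ABC.ABC.Cruxes.EisensteinQuarantine.ForcedPairDlog.StubIdeas1

open scoped BigOperators MatrixGroups ModularForm
open CongruenceSubgroup
open Literature.NumberTheory.Automorphic Literature.NumberTheory.EllipticCurves
open Literature.NumberTheory.EllipticCurves.ModularForms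
open Literature.NumberTheory.Automorphic.BCDT Literature.NumberTheory.GaloisRepresentations
open Summit.ABC.ABC.Theorems.EisensteinQuarantine.Negative
open WeierstrassCurve

/-! ## P1 — the stub IS the route item (closers by name) -/

/-- The registered stub statement is literally the route item `FreyModularity` (stmt-ABC-11340). -/
example : Summit.ABC.ABC.Theses.DefiniteXi.FreyModularity =
    (∀ a b : ℤ, IsCoprime a b → a * b * (a + b) ≠ 0 → ∀ (N : ℕ) [NeZero N],
      (freyCurve a b).conductorNorm ℤ = N →
        Nonempty (ModularParametrizationData (freyCurve a b) N)) := rfl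

/-- P1 closer (landed umbrella, one hypothesis: CDT 1999 Thm 7.1.2). -/
theorem stub_freyModularity_of_CDT_theorem_7_1_2 (h : CDT_theorem_7_1_2) :
    Summit.ABC.ABC.Theses.DefiniteXi.FreyModularity :=
  Summit.ABC.ABC.Theorems.freyModularity_of_CDT_theorem_7_1_2' h

/-- P1 closer (landed umbrella, one hypothesis: BCDT Thm A in form (2)). -/
theorem stub_freyModularity_of_exists_isNewformOf (h : exists_isNewformOf) :
    Summit.ABC.ABC.Theses.DefiniteXi.FreyModularity :=
  Summit.ABC.ABC.Theorems.freyModularity_of_exists_isNewformOf' h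

/-! ## P3 — use-site scope: the forced family in case A -/

/-- **D1.** `FreyModularity` restricted to the line's USE-SITE: the forced Frey curves
`E_(−ℓ, ℓ−1)` (`ℓ` prime, `32 ∣ ℓ − 1`) with the extra supply condition `ℓ ≡ 2 (mod 3)`. -/
def FreyModularityForced : Prop :=
  ∀ ℓ : ℕ, ℓ.Prime → 32 ∣ ℓ - 1 → ℓ % 3 = 2 →
    ∀ (N : ℕ) [NeZero N], (freyCurve (-(ℓ : ℤ)) ((ℓ - 1 : ℕ) : ℤ)).conductorNorm ℤ = N →
      Nonempty (ModularParametrizationData (freyCurve (-(ℓ : ℤ)) ((ℓ - 1 : ℕ) : ℤ)) N)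

/-- Domain facts of the forced family: `(−ℓ) ⊥ (ℓ−1)` and `(−ℓ)(ℓ−1)(−1) = ℓ(ℓ−1) ≠ 0`. -/
theorem forced_domain {ℓ : ℕ} (hℓ : ℓ.Prime) :
    IsCoprime (-(ℓ : ℤ)) ((ℓ - 1 : ℕ) : ℤ) ∧
      (-(ℓ : ℤ)) * ((ℓ - 1 : ℕ) : ℤ) * (-(ℓ : ℤ) + ((ℓ - 1 : ℕ) : ℤ)) = ((ℓ * (ℓ - 1) : ℕ) : ℤ) ∧
      (-(ℓ : ℤ)) * ((ℓ - 1 : ℕ) : ℤ) * (-(ℓ : ℤ) + ((ℓ - 1 : ℕ) : ℤ)) ≠ 0 := by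
  have hℓ1 : 1 ≤ ℓ := hℓ.one_lt.le
  have hM0 : ℓ - 1 ≠ 0 := by have := hℓ.two_le; omega
  have hℓcast : (ℓ : ℤ) = ((ℓ - 1 : ℕ) : ℤ) + 1 := by
    rw [Nat.cast_sub hℓ1]; push_cast; ring
  have habc : (-(ℓ : ℤ)) * ((ℓ - 1 : ℕ) : ℤ) * (-(ℓ : ℤ) + ((ℓ - 1 : ℕ) : ℤ)) =
      ((ℓ * (ℓ - 1) : ℕ) : ℤ) := by
    push_cast; rw [hℓcast]; ring
  have hPM0 : ℓ * (ℓ - 1) ≠ 0 := Nat.mul_ne_zero hℓ.ne_zero hM0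
  refine ⟨?_, habc, ?_⟩
  · rw [IsCoprime.neg_left_iff, Int.isCoprime_iff_gcd_eq_one, Int.gcd_natCast_natCast]
    exact (Nat.coprime_self_sub_right hℓ1).mpr (Nat.coprime_one_right ℓ)
  · rw [habc]; exact_mod_cast hPM0

/-- `ℓ ≡ 2 (mod 3)` puts the forced curve in case A's hypothesis `3 ∤ abc`. -/
theorem forced_not_three_dvd {ℓ : ℕ} (hℓ : ℓ.Prime) (h3 : ℓ % 3 = 2) :
    ¬ (3 : ℤ) ∣ (-(ℓ : ℤ)) * ((ℓ - 1 : ℕ) : ℤ) * (-(ℓ : ℤ) + ((ℓ - 1 : ℕ) : ℤ)) := by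
  rw [(forced_domain hℓ).2.1]
  intro h
  have h' : (3 : ℕ) ∣ ℓ * (ℓ - 1) := by exact_mod_cast h
  rcases (Nat.Prime.dvd_mul Nat.prime_three).mp h' with h | h <;> omega

/-- `32 ∣ ℓ − 1` makes the forced curve Serre-normalised with squarefree conductor `rad(ℓ(ℓ−1))`. -/
theorem forced_squarefree_conductorNorm {ℓ : ℕ} (hℓ : ℓ.Prime) (h32 : 32 ∣ ℓ - 1) :
    Squarefree ((freyCurve (-(ℓ : ℤ)) ((ℓ - 1 : ℕ) : ℤ)).conductorNorm ℤ) := by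
  obtain ⟨hab, habc, h0⟩ := forced_domain hℓ
  have hℓ1 : 1 ≤ ℓ := hℓ.one_lt.le
  have hℓcast : (ℓ : ℤ) = ((ℓ - 1 : ℕ) : ℤ) + 1 := by
    rw [Nat.cast_sub hℓ1]; push_cast; ring
  have hb32 : (32 : ℤ) ∣ ((ℓ - 1 : ℕ) : ℤ) := by exact_mod_cast h32
  have ha4 : (-(ℓ : ℤ)) ≡ -1 [ZMOD 4] := by
    have h4 : (4 : ℤ) ∣ ((ℓ - 1 : ℕ) : ℤ) := (show (4 : ℤ) ∣ 32 by norm_num).trans hb32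
    have : (-(ℓ : ℤ)) = -1 - ((ℓ - 1 : ℕ) : ℤ) := by rw [hℓcast]; ring
    rw [this]
    calc -1 - ((ℓ - 1 : ℕ) : ℤ) ≡ -1 - 0 [ZMOD 4] :=
        Int.ModEq.sub_left _ ((Int.modEq_zero_iff_dvd).mpr h4)
      _ = -1 := by ring
  haveI := isElliptic_freyCurve h0
  rw [conductorNorm_freyCurve_serre hab h0 ha4 hb32]
  exact UniqueFactorizationMonoid.squarefree_radical

/-- **H0.** The item still closes the restricted stub (trivial specialisation). -/
theorem freyModularityForced_of_freyModularity
    (h : Summit.ABC.ABC.Theses.DefiniteXi.FreyModularity) : FreyModularityForced :=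
  fun ℓ hℓ _ _ N _ hN ↦ h _ _ (forced_domain hℓ).1 (forced_domain hℓ).2.2 N hN

/-- **H1.** On the forced family with `ℓ ≡ 2 (mod 3)`, CDT 1999 Thm 7.2.1 ALONE gives the datum:
case A by R3 (`isModular_freyCurve_of_CDT_theorem_7_2_1_of_not_three_dvd`, landed) and the landed
per-level equivalence `nonempty_modularParametrizationData_iff_isModularAt`. -/
theorem freyModularityForced_of_CDT_theorem_7_2_1 (h721 : CDT_theorem_7_2_1) : FreyModularityForced := by
  intro ℓ hℓ h32 h3 N _ hN
  obtain ⟨hab, -, h0⟩ := forced_domain hℓ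
  haveI := isElliptic_freyCurve h0
  haveI : NeZero ((freyCurve (-(ℓ : ℤ)) ((ℓ - 1 : ℕ) : ℤ)).conductorNorm ℤ) :=
    ⟨by rw [hN]; exact NeZero.ne N⟩
  have hmod : BCDT.IsModular (freyCurve (-(ℓ : ℤ)) ((ℓ - 1 : ℕ) : ℤ)) :=
    Summit.ABC.ABC.Theorems.isModular_freyCurve_of_CDT_theorem_7_2_1_of_not_three_dvd h721 hab h0
      (forced_not_three_dvd hℓ h3)
  subst hN
  exact (Summit.ABC.ABC.Theorems.nonempty_modularParametrizationData_iff_isModularAt _ _).mpr hmod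

/-- **H1′a.** BCDT (3) ⇒ (2) for curves of SQUAREFREE conductor, granted Eichler–Shimura ONLY:
Carayol's level theorem is the tree's theorem `IsNewformOf.level_eq_conductorNorm_of_squarefree` in
this scope and Faltings is `isIsogenous_iff_frobeniusTrace_eq_holds`.  Proof = the body of
`isModular_of_isModularGaloisRepTate_of_facts` with the last step replaced. -/
theorem isModular_of_isModularGaloisRepTate_of_eichlerShimura_of_squarefree
    (hES : eichlerShimuraConstruction)
    (W : WeierstrassCurve ℚ) [W.IsElliptic] [NeZero (W.conductorNorm ℤ)]
    (hsq : Squarefree (W.conductorNorm ℤ)) (ℓ : ℕ) [Fact ℓ.Prime]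
    (h : W.IsModularGaloisRepTate ℓ) : BCDT.IsModular W := by
  classical
  have hℓp : ℓ.Prime := Fact.out
  obtain ⟨N, hN, f, hf, hint, hcoeff⟩ := exists_rational_isNewform0_of_isModularGaloisRepTate' W ℓ h
  haveI : NeZero (N * (ℓ * W.conductorNorm ℤ)) :=
    ⟨mul_ne_zero (NeZero.ne N) (mul_ne_zero hℓp.ne_zero (NeZero.ne _))⟩
  obtain ⟨W', hW', hW'f, -⟩ := hES hf hint
  have hiso : IsIsogenous W W' := by
    refine WeierstrassCurve.isIsogenous_of_finite_setOf_LFunction_ne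
      isIsogenous_iff_frobeniusTrace_eq_holds W W' ?_
    refine (N * (ℓ * W.conductorNorm ℤ)).primeFactors.finite_toSet.subset ?_
    rintro p ⟨hp, hne⟩
    refine (Nat.mem_primeFactors_of_ne_zero (NeZero.ne _)).mpr ⟨hp, ?_⟩
    by_contra hpM
    exact hne (by exact_mod_cast (hcoeff p hp hpM).symm.trans (hW'f.2 p))
  have hWf : IsNewformOf W f := ⟨hf, fun n ↦ by rw [hW'f.2 n, hiso.LFunction_eq]⟩
  have hNE : N = W.conductorNorm ℤ := hWf.level_eq_conductorNorm_of_squarefree hsq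
  subst hNE
  exact ⟨f, hWf⟩

/-- **H1′b.** The restricted stub from the ATOMS of the FreyModularity line that survive in case A:
Langlands–Tunnell (`stub_modThree` shape), modularity lifting at `3` for curves semistable at `3`
(`stub_liftThree` shape: Wiles 1995 / Taylor–Wiles / Diamond 1996) and Eichler–Shimura — no lifting at
`5`, no `3–5` switch, Carayol proved (squarefree). -/
theorem freyModularityForced_of_atoms
    (hmod3 : ∀ (W : WeierstrassCurve ℚ) [W.IsElliptic] (ρ : ModPGaloisRep ℚ (ZMod 3) 2),
      W.IsTorsionGaloisRep 3 ρ → FramedRep.IsAbsolutelyIrreducible ρ → ρ.IsModular)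
    (hlift3 : ∀ (W : WeierstrassCurve ℚ) [W.IsElliptic] (ρ : ModPGaloisRep ℚ (ZMod 3) 2),
      W.IsTorsionGaloisRep 3 ρ → ρ.IsAbsIrreducibleOverSqrt (-3) → ¬ 9 ∣ W.conductorNorm ℤ →
      ρ.IsModular → W.IsModularGaloisRepTate 3)
    (hES : eichlerShimuraConstruction) : FreyModularityForced := by
  intro ℓ hℓ h32 h3 N _ hN
  obtain ⟨hab, -, h0⟩ := forced_domain hℓ
  haveI := isElliptic_freyCurve h0
  haveI : NeZero ((freyCurve (-(ℓ : ℤ)) ((ℓ - 1 : ℕ) : ℤ)).conductorNorm ℤ) :=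
    ⟨by rw [hN]; exact NeZero.ne N⟩
  obtain ⟨ρ, hρ⟩ := (freyCurve (-(ℓ : ℤ)) ((ℓ - 1 : ℕ) : ℤ)).exists_isTorsionGaloisRep 3
  have hirr : ρ.IsAbsIrreducibleOverSqrt (-3) :=
    Summit.ABC.ABC.Theorems.isAbsIrreducibleOverSqrt_negThree_freyCurve_of_not_three_dvd _ _ hab h0
      (forced_not_three_dvd hℓ h3) ρ hρ
  have h9 : ¬ 9 ∣ (freyCurve (-(ℓ : ℤ)) ((ℓ - 1 : ℕ) : ℤ)).conductorNorm ℤ :=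
    Summit.ABC.ABC.Theorems.not_nine_dvd_conductorNorm_freyCurve hab h0
  have hTate : (freyCurve (-(ℓ : ℤ)) ((ℓ - 1 : ℕ) : ℤ)).IsModularGaloisRepTate 3 :=
    hlift3 _ ρ hρ hirr h9 (hmod3 _ ρ hρ hirr.isAbsolutelyIrreducible)
  have hmod : BCDT.IsModular (freyCurve (-(ℓ : ℤ)) ((ℓ - 1 : ℕ) : ℤ)) :=
    isModular_of_isModularGaloisRepTate_of_eichlerShimura_of_squarefree hES _
      (forced_squarefree_conductorNorm hℓ h32) 3 hTate
  subst hN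
  exact (Summit.ABC.ABC.Theorems.nonempty_modularParametrizationData_iff_isModularAt _ _).mpr hmod

/-! ## P3 — the supply with a class condition mod 3 (helpers H2a–H2c, signatures only) -/

/-- **H2a (L).** Gallagher's lower bound shape for an ARBITRARY reduced class `a (mod d)` (the tree's
`primesInAP_lowerBound_shape` is class `1` only; the orthogonality step `primesInAP_lowerBound_of_sumBound`
carries a factor `conj (χ a)` of norm one — its `hsum` input is class-agnostic). -/
theorem primesInAP_lowerBound_shape_class :
    ∃ c₃ : ℝ, 0 < c₃ ∧ ∃ δ : ℝ, 0 < δ ∧ ∃ N₀ : ℕ, ∀ N : ℕ, N₀ ≤ N → ∃ b : ℕ, 2 ≤ b ∧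
      ((N : ℝ) ^ δ < b ∨
        ∃ (_ : NeZero b) (χe : DirichletCharacter ℂ b) (β : ℝ),
          Literature.NumberTheory.Sieve.MontgomeryVaughan1975.IsExceptionalZero c₃ ((N : ℝ) ^ δ) b χe β) ∧
      ∀ d : ℕ, 1 ≤ d → (d : ℝ) ≤ (N : ℝ) ^ δ → ¬ b ∣ d → ∀ a : ℕ, a.Coprime d →
        (1 / 2 : ℝ) * N / (Nat.totient d * Real.log N) ≤
          (((Finset.Iic N).filter (fun p => p.Prime ∧ p ≡ a [MOD d])).card : ℝ) := by
  sorry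

/-- **H2b (M).** A primitive quadratic character of conductor `3 · 2^k` has `k ≤ 3` (companion of the
tree's `PrimitiveQuadratic.level_two_pow_le_three`; `1 + 3·2^{k-1}` is a square unit mod `3·2^k`, `k ≥ 4`). -/
theorem level_three_mul_two_pow_le_three {k : ℕ} {χ : DirichletCharacter ℂ (3 * 2 ^ k)}
    (hprim : χ.IsPrimitive) (hquad : χ.IsQuadratic) : k ≤ 3 := by
  sorry

/-- **H2c (M).** The exceptional modulus divides no `3 · 2^s` in range (as
`exists_goodModulus_not_dvd_two_pow`: Page ⇒ quadratic ⇒ `b ∈ {3,4,8,12,24}` by H2b ⇒ `L(β,χ) ≠ 0`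
near `1` by `exists_eta_LFunction_ne_zero` at five fixed moduli), with the class-`a` count of H2a. -/
theorem exists_goodModulus_not_dvd_three_mul_two_pow :
    ∃ δ : ℝ, 0 < δ ∧ ∃ N₁ : ℕ, ∀ N : ℕ, N₁ ≤ N → ∃ b : ℕ, 2 ≤ b ∧
      (∀ s : ℕ, ((3 * 2 ^ s : ℕ) : ℝ) ≤ (N : ℝ) ^ δ → ¬ b ∣ 3 * 2 ^ s) ∧
      ∀ d : ℕ, 1 ≤ d → (d : ℝ) ≤ (N : ℝ) ^ δ → ¬ b ∣ d → ∀ a : ℕ, a.Coprime d →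
        (1 / 2 : ℝ) * N / (Nat.totient d * Real.log N) ≤
          (((Finset.Iic N).filter (fun p => p.Prime ∧ p ≡ a [MOD d])).card : ℝ) := by
  sorry

/-- **H2 (supply with the class condition).**  `A, s₁` with: for every `s ≥ s₁` primes `q`, `ℓ` with
`2^s ∣ q − 1`, `2^s q ∣ ℓ − 1`, `ℓ ≡ 2 (mod 3)`, `ℓ ≤ 2^{As}` — the tree's
`exists_primes_two_pow_mul_dvd_sub_one` with the second Gallagher call at modulus `3 · 2^s · q_i`, class
`a ≡ 1 (2^s q_i)`, `a ≡ 2 (3)` (H2a), exceptional modulus dividing at most one `3·2^s·q_i` (H2c). -/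
theorem exists_primes_two_pow_mul_dvd_sub_one_mod_three :
    ∃ A s₁ : ℕ, ∀ s : ℕ, s₁ ≤ s →
      ∃ q ℓ : ℕ, q.Prime ∧ ℓ.Prime ∧ 2 ^ s ∣ q - 1 ∧ 2 ^ s * q ∣ ℓ - 1 ∧ ℓ % 3 = 2 ∧
        ℓ ≤ 2 ^ (A * s) := by
  sorry

/-! ## P3 — re-composition of the line on the restricted family (H3, H4) -/

/-- **H3 (proved).** Rank one + the RESTRICTED modularity ⇒ the Frey eigen-line on the forced family
(p132391's proof, specialised). -/
theorem forcedEigenLine_of_rankOne_of_freyModularityForced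
    (h₁ : Summit.ABC.ABC.Theses.DefiniteXi.BrandtEigenLatticeRankOne) (h₂ : FreyModularityForced) :
    ∀ ℓ : ℕ, ℓ.Prime → 32 ∣ ℓ - 1 → ℓ % 3 = 2 →
      ∀ (N : ℕ) [NeZero N], (freyCurve (-(ℓ : ℤ)) ((ℓ - 1 : ℕ) : ℤ)).conductorNorm ℤ = N →
      Squarefree N → ℓ ∣ N →
      ∀ (S : Brandt.XiSetup (N / ℓ) ℓ) [Fintype (Brandt.ClassSet S.O)],
        ∃ φ : Brandt.ClassSet S.O → ℤ, φ ≠ 0 ∧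
          Brandt.eigenLattice (N / ℓ * ℓ) (Brandt.matrix S.O)
            (fun n => (freyCurve (-(ℓ : ℤ)) ((ℓ - 1 : ℕ) : ℤ)).LFunction n) = ℤ ∙ φ := by
  intro ℓ hℓ h32 h3 N _ hN hsq hℓN S _
  obtain ⟨hab, -, h0⟩ := forced_domain hℓ
  haveI := isElliptic_freyCurve h0
  have hNeq : N / ℓ * ℓ = N := Nat.div_mul_cancel hℓN
  haveI : NeZero (N / ℓ * ℓ) := ⟨by rw [hNeq]; exact NeZero.ne N⟩
  have hsq' : Squarefree (N / ℓ * ℓ) := by rw [hNeq]; exact hsq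
  have hN' : (freyCurve (-(ℓ : ℤ)) ((ℓ - 1 : ℕ) : ℤ)).conductorNorm ℤ = N / ℓ * ℓ :=
    hN.trans hNeq.symm
  obtain ⟨D⟩ := h₂ ℓ hℓ h32 h3 (N / ℓ * ℓ) hN'
  have h₁' : Literature.NumberTheory.EllipticCurves.takahashi2001_brandtEigenLattice_rank_one := h₁
  exact Summit.ABC.ABC.Theorems.exists_eq_span_singleton_of_finrank_eq_one _
    (h₁' (freyCurve (-(ℓ : ℤ)) ((ℓ - 1 : ℕ) : ℤ)) (N / ℓ) ℓ hℓ hsq' hN' D S)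

/-- **H4a (proved).** The skeleton's `forcedPairDepthLaw_of_occurrence` with the eigen-line
hypothesis RESTRICTED to the forced family in class `2 (mod 3)`; same proof, `hR` applied at
`ℓ` instead of `(a, b) = (−ℓ, ℓ−1)`; the conclusion gains the binder `ℓ % 3 = 2`. -/
theorem forcedPairDepthLaw_of_occurrence_mod_three
    (hR : ∀ ℓ : ℕ, ℓ.Prime → 32 ∣ ℓ - 1 → ℓ % 3 = 2 →
      ∀ (N : ℕ) [NeZero N], (freyCurve (-(ℓ : ℤ)) ((ℓ - 1 : ℕ) : ℤ)).conductorNorm ℤ = N →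
      Squarefree N → ℓ ∣ N →
      ∀ (S : Brandt.XiSetup (N / ℓ) ℓ) [Fintype (Brandt.ClassSet S.O)],
        ∃ φ : Brandt.ClassSet S.O → ℤ, φ ≠ 0 ∧
          Brandt.eigenLattice (N / ℓ * ℓ) (Brandt.matrix S.O)
            (fun n => (freyCurve (-(ℓ : ℤ)) ((ℓ - 1 : ℕ) : ℤ)).LFunction n) = ℤ ∙ φ)
    (hO : ∃ c : ℕ, ∀ q ℓ : ℕ, q.Prime → ℓ.Prime → q ≠ 2 → 32 * q ∣ ℓ - 1 →
      ∀ N : ℕ, (freyCurve (-(ℓ : ℤ)) ((ℓ - 1 : ℕ) : ℤ)).conductorNorm ℤ = N →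
      ∀ (S : Brandt.XiSetup (N / ℓ) ℓ) [Fintype (Brandt.ClassSet S.O)],
        ∀ φ : Brandt.ClassSet S.O → ℤ, φ ≠ 0 →
          Brandt.eigenLattice (N / ℓ * ℓ) (Brandt.matrix S.O)
              (fun n => (freyCurve (-(ℓ : ℤ)) ((ℓ - 1 : ℕ) : ℤ)).LFunction n) = ℤ ∙ φ →
          ∃ ψ : Brandt.ClassSet S.O → ℤ,
            ∑ i, (Brandt.weight S.O i : ℤ) * ψ i * φ i = 0 ∧
              ∀ i, ((2 ^ ((q - 1).factorization 2 - c) : ℕ) : ℤ) ∣ φ i - ψ i) :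
    ∃ c : ℕ, ∀ q ℓ : ℕ, q.Prime → ℓ.Prime → q ≠ 2 → 32 * q ∣ ℓ - 1 → ℓ % 3 = 2 →
      ∀ N : ℕ, (freyCurve (-(ℓ : ℤ)) ((ℓ - 1 : ℕ) : ℤ)).conductorNorm ℤ = N →
        2 ^ ((q - 1).factorization 2) ≤
          2 ^ c * ordProj[2] (brandtXi (N / ℓ) ℓ
            (fun n => (freyCurve (-(ℓ : ℤ)) ((ℓ - 1 : ℕ) : ℤ)).LFunction n)) := by
  -- the skeleton's proof of `forcedPairDepthLaw_of_occurrence`, `hR` applied on the family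
  obtain ⟨c, hc⟩ := hO
  refine ⟨c, fun q ℓ hq hℓ hq2 h32 h3 N hN => ?_⟩
  obtain ⟨hab, habc, h0⟩ := forced_domain hℓ
  have hℓ1 : 1 ≤ ℓ := hℓ.one_lt.le
  have hM0 : ℓ - 1 ≠ 0 := by have := hℓ.two_le; omega
  have h32' : (32 : ℕ) ∣ ℓ - 1 := (Dvd.intro q rfl).trans h32
  have hℓ2 : ℓ ≠ 2 := by
    intro h
    rw [h] at h32'
    norm_num at h32'
  have hnatAbs : ((-(ℓ : ℤ)) * ((ℓ - 1 : ℕ) : ℤ) * (-(ℓ : ℤ) + ((ℓ - 1 : ℕ) : ℤ))).natAbs =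
      ℓ * (ℓ - 1) := by rw [habc, Int.natAbs_natCast]
  haveI : (freyCurve (-(ℓ : ℤ)) ((ℓ - 1 : ℕ) : ℤ)).IsElliptic := isElliptic_freyCurve h0
  have hNsq : Squarefree N := by rw [← hN]; exact forced_squarefree_conductorNorm hℓ h32'
  have hℓcast : (ℓ : ℤ) = ((ℓ - 1 : ℕ) : ℤ) + 1 := by
    rw [Nat.cast_sub hℓ1]; push_cast; ring
  have hb32 : (32 : ℤ) ∣ ((ℓ - 1 : ℕ) : ℤ) := by exact_mod_cast h32'
  have ha4 : (-(ℓ : ℤ)) ≡ -1 [ZMOD 4] := by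
    have h4 : (4 : ℤ) ∣ ((ℓ - 1 : ℕ) : ℤ) := (show (4 : ℤ) ∣ 32 by norm_num).trans hb32
    have : (-(ℓ : ℤ)) = -1 - ((ℓ - 1 : ℕ) : ℤ) := by rw [hℓcast]; ring
    rw [this]
    calc -1 - ((ℓ - 1 : ℕ) : ℤ) ≡ -1 - 0 [ZMOD 4] :=
        Int.ModEq.sub_left _ ((Int.modEq_zero_iff_dvd).mpr h4)
      _ = -1 := by ring
  have hNval : N = UniqueFactorizationMonoid.radical (ℓ * (ℓ - 1)) := by
    rw [← hN, conductorNorm_freyCurve_serre hab h0 ha4 hb32, hnatAbs]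
  have hNpos : 0 < N := by rw [hNval]; exact Nat.radical_pos _
  haveI : NeZero N := ⟨hNpos.ne'⟩
  have hℓN : ℓ ∣ N := by
    rw [hNval]
    refine Nat.dvd_of_mem_primeFactors ?_
    rw [Nat.primeFactors_radical, Nat.primeFactors_mul hℓ.ne_zero hM0, hℓ.primeFactors]
    simp
  have hodd : Odd ℓ := hℓ.odd_of_ne_two hℓ2
  have hcard : Odd ℓ.primeFactors.card := by rw [hℓ.primeFactors]; simp
  -- a Brandt setup of type `(N/ℓ, ℓ)` exists and computes `ξ`
  have hne := Summit.ABC.ABC.Theorems.XiBound.Negative.nonempty_xiSetup_freyCurve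
    hab h0 hodd hℓ.squarefree hcard (by rw [hN]; exact hℓN)
  rw [hN] at hne
  obtain ⟨S⟩ := hne
  letI : Fintype (Brandt.ClassSet S.O) := Fintype.ofFinite _
  rw [S.brandtXi_eq_xi]
  -- H3: the eigen-line ON THE FAMILY; stub 3: the occurrence witness; landed dictionary: the depth
  obtain ⟨φ, hφ, hL⟩ := hR ℓ hℓ h32' h3 N hN hNsq hℓN S
  obtain ⟨ψ, hψ, hcong⟩ := hc q ℓ hq hℓ hq2 h32 N hN S φ hφ hL
  have hle := Summit.ABC.ABC.Theorems.pow_le_ordProj_xi_of_occurrence Nat.prime_two S _ hφ hL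
    ((q - 1).factorization 2 - c) hψ hcong
  calc 2 ^ ((q - 1).factorization 2)
      ≤ 2 ^ (c + ((q - 1).factorization 2 - c)) := Nat.pow_le_pow_right (by norm_num) (by omega)
    _ = 2 ^ c * 2 ^ ((q - 1).factorization 2 - c) := pow_add _ _ _
    _ ≤ 2 ^ c * ordProj[2] (S.xi fun n => (freyCurve (-(ℓ : ℤ)) ((ℓ - 1 : ℕ) : ℤ)).LFunction n) :=
        Nat.mul_le_mul_left _ hle

/-- **H4b (proved).** Restricted supply + restricted depth law ⇒ `ProthDepthFamily` (the skeleton's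
`prothDepthFamily_of_forcedPairDepthLaw`, threading `ℓ % 3 = 2`). -/
theorem prothDepthFamily_of_forcedPairDepthLaw_mod_three
    (hSup : ∃ A s₁ : ℕ, ∀ s : ℕ, s₁ ≤ s →
      ∃ q ℓ : ℕ, q.Prime ∧ ℓ.Prime ∧ 2 ^ s ∣ q - 1 ∧ 2 ^ s * q ∣ ℓ - 1 ∧ ℓ % 3 = 2 ∧
        ℓ ≤ 2 ^ (A * s))
    (hF : ∃ c : ℕ, ∀ q ℓ : ℕ, q.Prime → ℓ.Prime → q ≠ 2 → 32 * q ∣ ℓ - 1 → ℓ % 3 = 2 →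
      ∀ N : ℕ, (freyCurve (-(ℓ : ℤ)) ((ℓ - 1 : ℕ) : ℤ)).conductorNorm ℤ = N →
        2 ^ ((q - 1).factorization 2) ≤
          2 ^ c * ordProj[2] (brandtXi (N / ℓ) ℓ
            (fun n => (freyCurve (-(ℓ : ℤ)) ((ℓ - 1 : ℕ) : ℤ)).LFunction n))) :
    ProthDepthFamily := by
  obtain ⟨A, s₁, hAs⟩ := hSup
  obtain ⟨c, hc⟩ := hF
  refine ⟨c, A, fun s₀ => ?_⟩
  set s : ℕ := max s₀ (max s₁ 5) with hs
  have hs5 : 5 ≤ s := (le_max_right _ _).trans (le_max_right _ _)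
  have hs₁ : s₁ ≤ s := (le_max_left _ _).trans (le_max_right _ _)
  have h32s : (32 : ℕ) ∣ 2 ^ s := by
    rw [show (32 : ℕ) = 2 ^ 5 by norm_num]; exact Nat.pow_dvd_pow 2 hs5
  obtain ⟨q, ℓ, hq, hℓ, hsq, hsl, hℓ3, hℓA⟩ := hAs s hs₁
  have hq2 : q ≠ 2 := by
    intro h
    rw [h] at hsq
    have := Nat.le_of_dvd (by norm_num) (h32s.trans hsq)
    omega
  have h2sl : 2 ^ s ∣ ℓ - 1 := (Dvd.intro q rfl).trans hsl
  have h32q : 32 * q ∣ ℓ - 1 := (Nat.mul_dvd_mul_right h32s q).trans hsl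
  refine ⟨s, ℓ, le_max_left _ _, hℓ, h2sl, hℓA, fun N hN => ?_⟩
  have h := hc q ℓ hq hℓ hq2 h32q hℓ3 N hN
  have hqm1 : q - 1 ≠ 0 := by have := hq.two_le; omega
  have hsv : s ≤ (q - 1).factorization 2 :=
    (Nat.prime_two.pow_dvd_iff_le_factorization hqm1).mp hsq
  exact (Nat.pow_le_pow_right (by norm_num) hsv).trans h

/-- **The restricted composition** (what `ProthDepthFamily_of` becomes): rank one (item 17203) +
`FreyModularityForced` (H1/H1′b instead of the full item 11340) + stub 3 + the class-`2 (mod 3)` supply. -/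
theorem prothDepthFamily_of_forced
    (h₁ : Summit.ABC.ABC.Theses.DefiniteXi.BrandtEigenLatticeRankOne) (h₂ : FreyModularityForced)
    (hO : ∃ c : ℕ, ∀ q ℓ : ℕ, q.Prime → ℓ.Prime → q ≠ 2 → 32 * q ∣ ℓ - 1 →
      ∀ N : ℕ, (freyCurve (-(ℓ : ℤ)) ((ℓ - 1 : ℕ) : ℤ)).conductorNorm ℤ = N →
      ∀ (S : Brandt.XiSetup (N / ℓ) ℓ) [Fintype (Brandt.ClassSet S.O)],
        ∀ φ : Brandt.ClassSet S.O → ℤ, φ ≠ 0 →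
          Brandt.eigenLattice (N / ℓ * ℓ) (Brandt.matrix S.O)
              (fun n => (freyCurve (-(ℓ : ℤ)) ((ℓ - 1 : ℕ) : ℤ)).LFunction n) = ℤ ∙ φ →
          ∃ ψ : Brandt.ClassSet S.O → ℤ,
            ∑ i, (Brandt.weight S.O i : ℤ) * ψ i * φ i = 0 ∧
              ∀ i, ((2 ^ ((q - 1).factorization 2 - c) : ℕ) : ℤ) ∣ φ i - ψ i)
    (hSup : ∃ A s₁ : ℕ, ∀ s : ℕ, s₁ ≤ s →
      ∃ q ℓ : ℕ, q.Prime ∧ ℓ.Prime ∧ 2 ^ s ∣ q - 1 ∧ 2 ^ s * q ∣ ℓ - 1 ∧ ℓ % 3 = 2 ∧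
        ℓ ≤ 2 ^ (A * s)) :
    ProthDepthFamily :=
  prothDepthFamily_of_forcedPairDepthLaw_mod_three hSup
    (forcedPairDepthLaw_of_occurrence_mod_three
      (forcedEigenLine_of_rankOne_of_freyModularityForced h₁ h₂) hO)

/-- **End-to-end on the trust base `{BrandtEigenLatticeRankOne, CDT_theorem_7_2_1, stub 3}`** (+ H2, H4a):
the crux is refuted without `FreyModularity` in full. -/
theorem eisensteinQuarantine_false_of_forced
    (h₁ : Summit.ABC.ABC.Theses.DefiniteXi.BrandtEigenLatticeRankOne) (h721 : CDT_theorem_7_2_1)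
    (hO : ∃ c : ℕ, ∀ q ℓ : ℕ, q.Prime → ℓ.Prime → q ≠ 2 → 32 * q ∣ ℓ - 1 →
      ∀ N : ℕ, (freyCurve (-(ℓ : ℤ)) ((ℓ - 1 : ℕ) : ℤ)).conductorNorm ℤ = N →
      ∀ (S : Brandt.XiSetup (N / ℓ) ℓ) [Fintype (Brandt.ClassSet S.O)],
        ∀ φ : Brandt.ClassSet S.O → ℤ, φ ≠ 0 →
          Brandt.eigenLattice (N / ℓ * ℓ) (Brandt.matrix S.O)
              (fun n => (freyCurve (-(ℓ : ℤ)) ((ℓ - 1 : ℕ) : ℤ)).LFunction n) = ℤ ∙ φ →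
          ∃ ψ : Brandt.ClassSet S.O → ℤ,
            ∑ i, (Brandt.weight S.O i : ℤ) * ψ i * φ i = 0 ∧
              ∀ i, ((2 ^ ((q - 1).factorization 2 - c) : ℕ) : ℤ) ∣ φ i - ψ i) :
    ¬ Summit.ABC.ABC.Theses.DefiniteXi.EisensteinQuarantine :=
  EisensteinQuarantine_false_of_ProthDepthFamily
    (prothDepthFamily_of_forced h₁ (freyModularityForced_of_CDT_theorem_7_2_1 h721) hO
      exists_primes_two_pow_mul_dvd_sub_one_mod_three)

end Summit.ABC.ABC.Cruxes.EisensteinQuarantine.ForcedPairDlog.StubIdeas1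

end
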